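import Mathlib
import HarnessLib
import HarnessLib.Audit
import Summits.ValiantsHypothesis.Statement
import Literature.Computability.AlgebraicComplexity.CircuitDepth
import Literature.Computability.AlgebraicComplexity.ValiantConjectureProofs
import HarnessLib.Audit.Status.Attr

/-!
Route: ElementaryWordLength

DORMANT since 2026-08-23T14:37:24Z (reconciler: no traction for 6.1 d (last activity item-evidence-added at 2026-08-17T12:02:15Z); parked, not closed — `ledger route dormant route-ValiantsHypothesis-ElementaryWordLength --off` to reacti) — unstaffed, not closed; items shared with open routes are served there. `ledger route dormant <id> --off` reactivates.

# Route ElementaryWordLength — no quasi-polynomial elementary words for the transvection E_13(per_n)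
in E_3(ℂ[x]) — formula size as word length, by segment counting, reads and Steinberg alternation

X (WordLengthQP): there is no c such that for every n the transvection E_13(per_n) = I + per_n·e_13
∈ SL_3(ℂ[x_11,…,x_nn]) is a product
of at most 2^((log₂ n + c)^c) elementary LETTERS E_ij(λ) and E_ij(λ·x_kl) (i ≠ j, λ ∈ ℂ) — the word
length wl(per_n) of the permanent
transvection over the degree-≤1 elementary generators of E_3(ℂ[x̄]) is not quasi-polynomially
bounded. Card realised: elementary-word-length
(spine). The word predicate is inlined (a word = List of letters (i, j, λ, Option variable) ↦
product of `Matrix.transvection`), so every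
item elaborates over Mathlib + `perPoly` today. By Ben-Or–Cleve (a fan-in-2 formula of depth d gives
a word of length ≤ 4^d; a word of
length L gives a formula of size ≤ 20(L+1)³) and Brent/Hyafil–VSBR (BCS97 (21.33) VQP_e = VQP,
(21.35)), X ⟺ per ∉ VQF = VQP: the
Extended Valiant Hypothesis (BCS97 (21.32), (21.41)) in word form — the same X as route DetQP's
target up to printed equivalences, reached
from the FORMULA side, which no open route of the summit touches.
Lean: `¬ ∃ c : ℕ, ∀ n : ℕ, (∃ w : List (Fin 3 × Fin 3 × ℂ × Option (Fin n × Fin n)), w.length ≤ 2 ^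
((Nat.log 2 n + c) ^ c) ∧ (∀ l ∈ w, l.1 ≠ l.2.1) ∧ (w.map (fun l => Matrix.transvection l.1 l.2.1
(MvPolynomial.C l.2.2.1 * l.2.2.2.elim 1 MvPolynomial.X))).prod = Matrix.transvection (0 : Fin 3) 2
(Literature.Computability.AlgebraicComplexity.perPoly (Fin n) ℂ))`

## Assembly
Contraposition plus the shared hub: if per were a VP family, VpWordQp would give quasi-polynomial
words for E_13(per_n), contradicting
X; hence ¬IsVPFamily(per), and the hub argument (Theorems/HubHub.lean, item
stmt-ValiantsHypothesis-0317) with the renaming bridge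
`perFamily ℂ ∈ VP ℂ ↔ IsVPFamily per` and per ∈ VNP [Valiant1979; Burgisser2000 Thm 2.10] gives VP ℂ
≠ VNP ℂ. Pure logic given the
hypotheses (theorem `assembly_holds` in the planner's Sketch.lean proves this Assembly outright).

Rationale: WHY THIS LINE. Ben-Or–Cleve's register simulation [BenOrCleve1992] makes the affine elementary word
length of E_13(f) a faithful copy of formula size
(4^depth above, L^2.59 below), so lower bounds for VQF become statements about the distortion of ONE
explicit unipotent element of a
linear group over a polynomial ring, where three toolboxes that formula complexity has not used
apply: (E1) the segment decomposition
M₀·E(x)·M₁·E(x)⋯ of a word along the letters of a variable block B — each B-free segment is a point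
of SL_3 over the other variables (9
coordinates), so Kalorkoti's transcendence-degree count [Kalorkoti1985; BCS97 notes p.578: E(DET_n)
= Ω(n³)] transplants to words with
ceiling N² = n⁴ (crux 3 calibrates it at n³, crux 2 asks to pass the ceiling); (E2) a word is a
width-3 OBLIVIOUS branching program whose
layers are unipotent one-letter matrices, so Nisan/AFSSV evaluation-dimension arguments [Nisan1991;
AndersonForbesSaptharishiShpilkaVolk2018] bound read
multiplicity (crux 5), and 0/1-substitution maps letters to letters and per_n to sub-permanents — a
self-reduction/amplification step
native to this model; (E3) the group structure proper: upper-unitriangular words compute only degree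
≤ 2 (Heisenberg group), so all
degree growth comes from the Steinberg relation [E_12(a),E_23(b)] = E_13(ab) across ≥ deg/2
alternations between opposite unipotent
subgroups — Bruhat-cell bookkeeping to be combined with (E1)/(E2). Imported areas: K-theory /
combinatorial group theory of E_n over
polynomial rings (Cohn 1966, Suslin 1977, [vanderKallen1982]: SL_3(ℂ[x]) has unbounded elementary
word length, a non-explicit counting
analogue of Shannon; Nica arXiv:1901.00587: bounded generation over F_q[x] for unrestricted letters,
so invariants must see the
degree-≤1 filtration), lower bounds for bounded-width and oblivious programs
[BarringtonStraubing1995; AllenderWang2016;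
ChatterjeeKumarSheVolk2022]. Settled in this planning pass (numbers, not hopes): the card's bet (B1)
multi-valuation building
displacement is DEAD for super-polynomial bounds — at every base point of every Bruhat–Tits building
the displacement of E_13(f) is at
most deg f times the largest letter displacement (β₁₃ ≤ β₁₂ + β₂₃, β_ij + β_ji ≥ 0, v(f) ≥ deg f ·
min_k v(x_k)), so any weighted family
of valuations certifies at most deg × #letter classes = 6n(n²+1) = O(n³); bet (B2) Steinberg area
has no statement and is not filed.

RANKED CRUXES. #0 WordLengthQP (target) — X — the affine elementary word length of E_13(per_n) in
E_3(ℂ[x_11..x_nn]) is not quasi-polynomially bounded (card elementary-word-length, crux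
WordLengthQP). (why it might fail: Equivalent (BOC + Brent/VSBR) to per ∉ VQP = VQF, the Extended
Valiant Hypothesis [BCS97 (21.32)/(21.41), Problem 21.5: open], strictly stronger than VH: fails if
per_n has formulas of size n^O(log n), which is compatible with VP ≠ VNP.) [BenOrCleve1992,
BurgisserClausenShokrollahi1997, Burgisser2000, vanderKallen1982]
#2 WordPerSuperQuartic (crux) — for some ε > 0 and all large n, every affine elementary word for
E_13(per_n) has length ≥ n^(4+ε) — the first bound beyond the ceiling N² = n⁴ of segment/leaf
counting in the word model (N = n² variables); the step that needs a new invariant (E2 amplification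
or E3). [deps: WordPerCubic] [difficulty: open-problem] (why it might fail: False iff per_n has
words of length n^(4+o(1)) (formulas of size ≈ n^10.4), which no theorem excludes; and every engine
in hand stops below it: segment/transcendence counting caps at N² = n⁴, building displacement at
deg·#letters = O(n³), read-multiplicity at +O(log n).) [Kalorkoti1985, ChatterjeeKumarSheVolk2022,
AndersonForbesSaptharishiShpilkaVolk2018, BurgisserClausenShokrollahi1997]
#3 WordPerCubic (crux) — calibration (card crux rank 3, Kalorkoti in the word model): for some c > 0
and all large n, every affine elementary word for E_13(per_n) has length ≥ c·n³ — transplant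
Kalorkoti's transcendence-degree measure through the segment decomposition (each B-free segment
carries ≤ 9 parameters); trivial bound is n². [difficulty: L] (why it might fail: Kalorkoti's Ω(n³)
is printed for FORMULAS of DET [BCS97 p.578]; per's coefficient-field transcendence count is
unverified, and words may be polynomially shorter than formulas (only E(f) ≤ 20(wl+1)³ is known), so
wl(per_n) = o(n³) is not excluded — a refutation would itself be news.) [Kalorkoti1985,
BurgisserClausenShokrollahi1997, BenOrCleve1992]
#4 WordPerSuperPoly (crux) — milestone (VNP ⊄ VF in word form): for every c there is n such that
E_13(per_n) has no affine elementary word of length ≤ n^c + c — per_n has no polynomial-length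
words, equivalently no polynomial-size formulas. [deps: WordPerSuperQuartic] [difficulty:
open-problem] (why it might fail: Equivalent by BOC both ways to VNP ⊄ VP_e over ℂ (per has no
polynomial-size formulas), open since Valiant 1979; false if per has poly-size formulas; it gives VH
only together with VP ⊆ VQF, so it is weaker than X and a milestone, not the thesis.) [Valiant1979,
Burgisser2000, BenOrCleve1992, Raz2009, HrubesYehudayoff2011]
#5 UnboundedReads (crux) — read multiplicity must grow (E2 foothold): for every k and all large n,
every affine elementary word for E_13(per_n) contains some variable x_ij in more than k letters —
words are width-3 oblivious ABPs with unipotent layers, and read-k oblivious width-3 programs have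
bounded evaluation dimension (AFSSV), while per_n should have coefficient rank 2^Ω(n) under the
partitions the read pattern forces. [difficulty: M] (why it might fail: AFSSV's width bound
exp(n/k^O(k)) is for a designed polynomial with full rank under all relevant partitions; per_n has
n! monomials and the needed lemma (rank ≥ 2^Ω(n) of per's coefficient matrix under the ADAPTIVE,
possibly lopsided partitions) is not in print; reach is only k ~ log n/log log n.)
[AndersonForbesSaptharishiShpilkaVolk2018, Nisan1991, Raz2009, AllenderWang2016]
#9 VpWordQp (support) — VP ⊆ VQF in word form (hypothesis of the assembly): every VP family has
affine elementary words of quasi-polynomial length — compose the VSBR stage recursion (in-tree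
GateQuotients / VPDeterminantalQPProofs template, HasInvRepr ↦ words) with the word algebra:
concatenation for sums, the commutator [E_12(f),E_23(g)] = E_13(fg) with signed-permutation and
diagonal conjugations for products, ≤ #vars+1 letters for an affine form. [difficulty: M]
[ValiantSkyumBerkowitzRackoff1983, BenOrCleve1992, BurgisserClausenShokrollahi1997,
Literature.Computability.AlgebraicComplexity.isQPBounded_determinantalComplexity_of_isVPFamily_holds]
#9 BocSimulation (support) — Ben-Or–Cleve Thm 1 on the tree's circuits: a fan-in-≤2 circuit
(weighted sums, products) of depth d computing f yields an affine elementary word of length ≤ 4^d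
for E_13(f) (sum: concatenate; product: four conjugated copies; scalars by diagonal conjugation;
leaves one letter). [difficulty: provable-now] [BenOrCleve1992, BurgisserClausenShokrollahi1997]
#9 WordToFormula (support) — the converse dictionary row: a word of length L for E_13(f) gives a
fan-in-2 formula of size ≤ 20(L+1)³ for f (divide and conquer on the matrix product: F(L) ≤
6F(L/2)+5, exponent log₂6 < 2.59). [difficulty: provable-now] [BenOrCleve1992,
BringmannIkenmeyerZuiddam2018, BurgisserClausenShokrollahi1997]

TWO-LAYER PLAN. Foreseen glued splits (k ≤ 3, depth 1; nothing filed now): WordPerCubic ⇐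
SegmentTranscendence (a word with ℓ_B letters in block B
makes the coefficient field of the (1,3) entry over ℂ(other variables)[B] have transcendence degree
≤ 9(ℓ_B+1)+ℓ_B) → KalorkotiMeasurePer
(Σ_B td_B(per_n) ≥ c·n³ for Kalorkoti's blocks) → WordPerCubic. UnboundedReads ⇐ ReadKEvalDim
(width-3 read-k words have evaluation
dimension ≤ 3^(k^O(k)) for an adapted partition) → PerRankAllPartitions (per_n has coefficient rank
≥ 2^Ω(n) under those partitions) →
UnboundedReads. VpWordQp ⇐ WordAlgebra (HasWord closure under +, ×, scalars, affine forms) →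
VSBRStageWords → VpWordQp.

KILL CRITERIA. WordPerCubic REFUTED (per_n has words of length o(n³)): words are polynomially more
succinct than formulas on per itself and E1 is void
— pivot the polynomial rungs to `formulaComplexity` or close `refuted:WordPerCubic` if the witness
is structural (n^(2+o(1)) words).
UnboundedReads refuted (read-O(1) words for per_n, of length O(n²) once constant runs are collapsed
in SL_3(ℂ)) would put per in VP_e:
first suspect the encoding (refuter check: i = j letters are excluded; λ = 0 letters are
identities), else close. DetQP's target refuted
(per a qp-projection of det ⟺ per ∈ VQP = VQF ⟺ ¬X): close `refuted:WordLengthQP`; per ∈ VP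
(DetQP.NegPerInVp proved) moots the summit
side. Engine death without refutation: a proof that every word invariant which is a function of the
segment parameters (E1) or of entry
valuations (B1, already capped here) is poly(n) on E_13(per_n), together with UnboundedReads capped
at O(log n), leaves no
super-polynomial engine — planner closes `exhausted` unless E3 has produced a typed statement by
then.

NOT DECOMPOSED YET. E3 (Steinberg/Bruhat alternation bookkeeping) has no statement until E1/E2 land;
the segment lemma and per's Kalorkoti measure (children
of WordPerCubic); the all-partitions rank lemma for per (child of UnboundedReads); LinearDictionary
(is E(f) ≤ C·wl(E_13 f)? open either
way, deliberately not filed); border words (closure of length-L words; BIZ18 border width-2 = VF);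
the width-2 row of the dictionary
(AllenderWang2016 non-universality vs Cohn's standard form = BIZ18 continuants: known, not filed);
constants in {0,±1} vs ℂ; the
negation ¬X (= per ∈ VQF) is DetQP's ¬target and is not re-filed here.

CHEAPEST FALSIFIER. (1) One page, refuter first: does Kalorkoti's count transplant — the ≤ ℓ_B+1
maximal B-free segments of a word are matrices over
ℂ[other variables] with 9 entries each, so the coefficient field of the (1,3) entry as a polynomial
in the B-variables has transcendence
degree ≤ 9(ℓ_B+1)+ℓ_B over ℂ; if this fails (it would if affine-form letters were allowed — they are
NOT: a letter is λ or λ·x_kl), crux 3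
loses its engine and the route its calibration. (2) Lookup: Kalorkoti1985 §4 computes the measure
for det (BCS97 p.578); is per's
analogue ≥ c·n³ in print or a one-line variant? (3) Not run (hub compute-free, plancard files no
jobs): BFS over words with λ ∈ {±1} for
the exact lengths of E_13(x₁x₂+x₃x₄), per_2 = det_2 (equal by letter scaling), per_3 vs det_3 — a
per/det gap already at n = 3 would show
which signs an invariant must see.

NUMBERS. Trivial: wl(E_13 per_n) ≥ n² (every variable occurs). BOC: wl ≤ 4^D(f) ≤ 4·E(f)^5.77 (Brent
D ≤ (2/log₂φ)·log₂E + 1, BCS97 (21.35) printed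
p.563). Converse: E(f) ≤ 20(wl+1)³. Ryser: E(per_n) = O(n²2ⁿ) ⇒ wl(per_n) = 2^O(n). Kalorkoti:
E(det_n) = Ω(n³) (BCS97 notes printed p.578).
Formula/ABP record Ω(N²) for explicit N-variate polynomials [ChatterjeeKumarSheVolk2022].
Segment-counting ceiling in the word model: N² =
n⁴. Valuation/building cap: deg × 6(n²+1) = O(n³) (this pass). Multilinear formulas for per/det:
n^Ω(log n) [Raz2009]. Read-k oblivious
ABPs: width ≥ exp(n/k^O(k)) for an explicit f [AndersonForbesSaptharishiShpilkaVolk2018].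
Bounded-width Boolean programs: length Ω(n log log n)
[BarringtonStraubing1995]. Items at open: 10 (1 target, 4 cruxes, 3 support, 1 assembly… = 9 decls +
0 definitions).

DEFINITION REQUESTS. None filed: the word predicate is inlined (List (Fin 3 × Fin 3 × ℂ × Option σ)
↦ product of Matrix.transvection l.1 l.2.1 (C λ · (1 | X k))
= Matrix.transvection 0 2 f) over Mathlib + perPoly; a named `elemWordLength` (van der Kallen / Nica
word length in E_n(R) with a
generating family) under Literature/Algebra may be requested by the first prover who wants it, with
equivalence to the inline form as a
support lemma. Bib keys added this pass: BenOrCleve1992, Kalorkoti1985, AllenderWang2016,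
ChatterjeeKumarSheVolk2022,
BarringtonStraubing1995, vanderKallen1982 (pending, CLI outage:
AndersonForbesSaptharishiShpilkaVolk2018 = AndersonForbesSaptharishiShpilkaVolk2018,
BringmannIkenmeyerZuiddam2018 = doi:10.1145/3209663, Raz2009 = doi:10.1145/1502793.1502797).

Novelty: Searches (2026-08-15): lit search --source crossref "Kalorkoti lower bound formula size rational
functions" (6; Kalorkoti1985); --source
zbmath "oblivious algebraic branching programs lower bounds" (7: AFSSV 2018
AndersonForbesSaptharishiShpilkaVolk2018, Forbes–Saptharishi–Shpilka 2014,
Arvind–Raja 2016, Bhargav–Dwivedi–Saxena 2024); --source zbmath "quadratic lower bound algebraic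
branching programs" (6: Kumar 2019,
ChatterjeeKumarSheVolk2022, Gesmundo–Ghosal–Ikenmeyer–Lysikov 2022); --source crossref "lower bounds
bounded width algebraic branching
programs" (8: BarringtonStraubing1995, Jansen 2008 doi:10.1007/978-3-540-85238-4_33 = acq-02288
paywalled, CKSV22); --source s2 "power of
algebraic branching programs of width two" (AllenderWang2016); lit search --hybrid "Ben-Or Cleve
three registers formula elementary
matrices" (books only: BCS97 pp.591–607, Landsberg2017 p.312, Arora–Barak p.283); lit frontier
ValiantsHypothesis --since 2021 (30 rows;
pertinent: arXiv:2302.06984 optimal depth-reduction for formulas, arXiv:2604.00746 unconditional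
barrier for multilinear ABP bounds,
arXiv:2604.22006 circuits over noncommutative rings); lit galaxy search "…width three algebraic
branching programs register programs
Ben-Or Cleve" --star all (service queued out twice, 0 rows — logged); plus the card audit's zbMATH
×4 / crossref / BIZ17 full-text grep
(nothing joins BOC to K_1/K_2/buildings). OpenAlex, Semantic Scholar and arXiv APIs were
rate-limited for most of the pass (logged in
N  [refs: 10.1007/978-3-540-85238-4_33, 10.1145/3209663, 2302.06984, 2604.00746, 2604.22006, 1901.00587, doi:10.1007/978-3-540-85238-4_33, doi:10.1145/3209663, Kalorkoti1985, AndersonForbesSaptharishiShpilkaVolk2018, ChatterjeeKumarSheVolk2022, BarringtonStraubing1995, AllenderWang2016, Landsberg2017, BenOrCleve1992, BringmannIkenmeyerZuiddam2018]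

Barriers (technique_class: group-word-length, register-programs, oblivious-abp): - technique_class: group-word-length, register-programs, oblivious-abp
- Literature.Barriers.ValiantsHypothesis.NoncommutativeExtensions: APPLIES by design
(HrubesYehudayoff2011_thm32: over a noncommutative R' ⊇ ℂ every degree-d n-variate f has formulas of
size O(dn), and BOC's commutator simulation is valid over any ring, so E_13(per_n) has poly(n) words
in E_3(R'[x̄])) — every invariant used must see commutativity of coefficients: E1 does
(transcendence degree over ℂ of coefficient FIELDS), E3 does (det = 1, minors, Mennicke-type
symbols); E2's coefficient-matrix rank does not obviously — conceded for UnboundedReads, whose reach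
is logarithmic anyway.
- Literature.Barriers.ValiantsHypothesis.FullRankMultilinear: applies to E2 only
(partial-derivative-matrix method capped at O(n³) for syntactically multilinear circuits,
RY08/AKV20); UnboundedReads asks k → ∞, far below the cap; the super-polynomial step is NOT claimed
from rank alone but from rank + 0/1 self-reduction, and restrictions of sm-circuits are sm-circuits,
so honestly: it does not evade it; the bet is that width 3 with unipotent layers, not polynomial
width, is where restriction amplification bites.
- Literature.Barriers.ValiantsHypothesis.RankMethods: N/A formally (EGOW18 tensor/Waring-rank
certification; likewise RankLifting GMOW19), but the sub-multiplicativity moral is why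
WordPerSuperQuartic is ranked hardest: a length invariant is sub-additive on words by construction.
- Literature.Barriers.ValiantsHypothesi

History (route lifecycle, newest last):
- 2026-08-16T04:20:16Z · AUTO-CRUX (backfill): WordLengthQP — hypotheses of the deciding theorem that nothing in the route derives are cruxes (operator:999:1085951)
- 2026-08-23T14:37:24Z · DORMANT — reconciler: no traction for 6.1 d (last activity item-evidence-added at 2026-08-17T12:02:15Z); parked, not closed — `ledger route dormant route-ValiantsHypothes (operator:999:1053530)

sub-problem: ValiantsHypothesis · status: dormant · opened planner-plancard-ValiantsHypothesis-ValiantsH-f90e976f-0 2026-08-15T11:49:08Z · rev 3 · ledger route-ValiantsHypothesis-ElementaryWordLength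
GENERATED by the gate from the ledger (D-0016/17). Provers cite these decls: `theorem foo : Summit.ValiantsHypothesis.ValiantsHypothesis.Theses.ElementaryWordLength.<Decl> := …` in Summits/ValiantsHypothesis/ValiantsHypothesis/Theorems/<Name>.lean.
-/

namespace Summit.ValiantsHypothesis.ValiantsHypothesis.Theses.ElementaryWordLength

open scoped BigOperators Topology Manifold Classical MeasureTheory ProbabilityTheory Matrix InnerProductSpace ComplexConjugate ContinuousMap
open Filter Set Function TopologicalSpace MeasureTheory

attribute [summit_statement] _root_.ValiantsHypothesis

open Literature.PNP

/-- item stmt-ValiantsHypothesis-6623 · crux (kind.auto-crux: conjecture-grade) · rank 0 · open · by planner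
why it might fail: Equivalent (BOC + Brent/VSBR) to per ∉ VQP = VQF, the Extended Valiant Hypothesis [BCS97 (21.32)/(21.41), Problem 21.5: open], strictly stronger than VH: fails if per_n has formulas of size n^O(log n), which is compatible with VP ≠ VNP.
sources: BenOrCleve1992, BurgisserClausenShokrollahi1997, Burgisser2000, vanderKallen1982
[target] X — the affine elementary word length of E_13(per_n) in E_3(ℂ[x_11..x_nn]) is not
quasi-polynomially bounded (card elementary-word-length, crux WordLengthQP). -/
@[route_item "route-ValiantsHypothesis-ElementaryWordLength", crux]
def WordLengthQP : Prop :=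
  ¬ ∃ c : ℕ, ∀ n : ℕ, (∃ w : List (Fin 3 × Fin 3 × ℂ × Option (Fin n × Fin n)), w.length ≤ 2 ^ ((Nat.log 2 n + c) ^ c) ∧ (∀ l ∈ w, l.1 ≠ l.2.1) ∧ (w.map (fun l => Matrix.transvection l.1 l.2.1 (MvPolynomial.C l.2.2.1 * l.2.2.2.elim 1 MvPolynomial.X))).prod = Matrix.transvection (0 : Fin 3) 2 (Literature.Computability.AlgebraicComplexity.perPoly (Fin n) ℂ))

/-- item stmt-ValiantsHypothesis-6624 · crux · rank 2 · open · by planner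
why it might fail: False iff per_n has words of length n^(4+o(1)) (formulas of size ≈ n^10.4), which no theorem excludes; and every engine in hand stops below it: segment/transcendence counting caps at N² = n⁴, building displacement at deg·#letters = O(n³), read-multiplicity at +O(log n).
sources: Kalorkoti1985, ChatterjeeKumarSheVolk2022, AndersonForbesSaptharishiShpilkaVolk2018, BurgisserClausenShokrollahi1997
[crux] for some ε > 0 and all large n, every affine elementary word for E_13(per_n) has length ≥
n^(4+ε) — the first bound beyond the ceiling N² = n⁴ of segment/leaf counting in the word model (N =
n² variables); the step that needs a new invariant (E2 amplification or E3). [deps: WordPerCubic]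
[difficulty: open-problem] -/
@[route_item "route-ValiantsHypothesis-ElementaryWordLength", crux]
def WordPerSuperQuartic : Prop :=
  ∃ ε : ℝ, 0 < ε ∧ ∃ n₀ : ℕ, ∀ n ≥ n₀, ∀ L : ℕ, (∃ w : List (Fin 3 × Fin 3 × ℂ × Option (Fin n × Fin n)), w.length ≤ L ∧ (∀ l ∈ w, l.1 ≠ l.2.1) ∧ (w.map (fun l => Matrix.transvection l.1 l.2.1 (MvPolynomial.C l.2.2.1 * l.2.2.2.elim 1 MvPolynomial.X))).prod = Matrix.transvection (0 : Fin 3) 2 (Literature.Computability.AlgebraicComplexity.perPoly (Fin n) ℂ)) → (n : ℝ) ^ (4 + ε) ≤ L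

/-- item stmt-ValiantsHypothesis-6625 · crux · rank 3 · closed · proved by Summit.ValiantsHypothesis.ValiantsHypothesis.Theorems.ElementaryWordLengthWordPerCubic.wordPerCubic_proof @ 037849741836 (prover) · by planner
why it might fail: Kalorkoti's Ω(n³) is printed for FORMULAS of DET [BCS97 p.578]; per's coefficient-field transcendence count is unverified, and words may be polynomially shorter than formulas (only E(f) ≤ 20(wl+1)³ is known), so wl(per_n) = o(n³) is not excluded — a refutation would itself be news.
sources: Kalorkoti1985, BurgisserClausenShokrollahi1997, BenOrCleve1992
[crux] calibration (card crux rank 3, Kalorkoti in the word model): for some c > 0 and all large n,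
every affine elementary word for E_13(per_n) has length ≥ c·n³ — transplant Kalorkoti's
transcendence-degree measure through the segment decomposition (each B-free segment carries ≤ 9
parameters); trivial bound is n². [difficulty: L] -/
@[route_item "route-ValiantsHypothesis-ElementaryWordLength", crux]
def WordPerCubic : Prop :=
  ∃ c : ℝ, 0 < c ∧ ∃ n₀ : ℕ, ∀ n ≥ n₀, ∀ L : ℕ, (∃ w : List (Fin 3 × Fin 3 × ℂ × Option (Fin n × Fin n)), w.length ≤ L ∧ (∀ l ∈ w, l.1 ≠ l.2.1) ∧ (w.map (fun l => Matrix.transvection l.1 l.2.1 (MvPolynomial.C l.2.2.1 * l.2.2.2.elim 1 MvPolynomial.X))).prod = Matrix.transvection (0 : Fin 3) 2 (Literature.Computability.AlgebraicComplexity.perPoly (Fin n) ℂ)) → c * (n : ℝ) ^ 3 ≤ L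

/-- item stmt-ValiantsHypothesis-6626 · crux · rank 4 · open · by planner
why it might fail: Equivalent by BOC both ways to VNP ⊄ VP_e over ℂ (per has no polynomial-size formulas), open since Valiant 1979; false if per has poly-size formulas; it gives VH only together with VP ⊆ VQF, so it is weaker than X and a milestone, not the thesis.
sources: Valiant1979, Burgisser2000, BenOrCleve1992, Raz2009, HrubesYehudayoff2011
[crux] milestone (VNP ⊄ VF in word form): for every c there is n such that E_13(per_n) has no affine
elementary word of length ≤ n^c + c — per_n has no polynomial-length words, equivalently no
polynomial-size formulas. [deps: WordPerSuperQuartic] [difficulty: open-problem] -/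
@[route_item "route-ValiantsHypothesis-ElementaryWordLength", crux]
def WordPerSuperPoly : Prop :=
  ∀ c : ℕ, ∃ n : ℕ, ¬ (∃ w : List (Fin 3 × Fin 3 × ℂ × Option (Fin n × Fin n)), w.length ≤ n ^ c + c ∧ (∀ l ∈ w, l.1 ≠ l.2.1) ∧ (w.map (fun l => Matrix.transvection l.1 l.2.1 (MvPolynomial.C l.2.2.1 * l.2.2.2.elim 1 MvPolynomial.X))).prod = Matrix.transvection (0 : Fin 3) 2 (Literature.Computability.AlgebraicComplexity.perPoly (Fin n) ℂ))

/-- item stmt-ValiantsHypothesis-6627 · crux · rank 5 · closed · proved by Summit.ValiantsHypothesis.ValiantsHypothesis.Theorems.ElementaryWordLengthUnboundedReads.UnboundedReads_proof @ 9cdc436e852d (prover) · by planner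
why it might fail: AFSSV's width bound exp(n/k^O(k)) is for a designed polynomial with full rank under all relevant partitions; per_n has n! monomials and the needed lemma (rank ≥ 2^Ω(n) of per's coefficient matrix under the ADAPTIVE, possibly lopsided partitions) is not in print; reach is only k ~ log n/log log n.
sources: AndersonForbesSaptharishiShpilkaVolk2018, Nisan1991, Raz2009, AllenderWang2016
[crux] read multiplicity must grow (E2 foothold): for every k and all large n, every affine
elementary word for E_13(per_n) contains some variable x_ij in more than k letters — words are
width-3 oblivious ABPs with unipotent layers, and read-k oblivious width-3 programs have bounded
evaluation dimension (AFSSV), while per_n should have coefficient rank 2^Ω(n) under the partitions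
the read pattern forces. [difficulty: M] -/
@[route_item "route-ValiantsHypothesis-ElementaryWordLength", crux]
def UnboundedReads : Prop :=
  ∀ k : ℕ, ∃ n₀ : ℕ, ∀ n ≥ n₀, ∀ w : List (Fin 3 × Fin 3 × ℂ × Option (Fin n × Fin n)), (∀ l ∈ w, l.1 ≠ l.2.1) → (w.map (fun l => Matrix.transvection l.1 l.2.1 (MvPolynomial.C l.2.2.1 * l.2.2.2.elim 1 MvPolynomial.X))).prod = Matrix.transvection (0 : Fin 3) 2 (Literature.Computability.AlgebraicComplexity.perPoly (Fin n) ℂ) → ∃ x : Fin n × Fin n, k < (w.filter (fun l => decide (l.2.2.2 = some x))).length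

/-- item stmt-ValiantsHypothesis-6628 · support · rank 9 · closed · proved by Summit.ValiantsHypothesis.ValiantsHypothesis.Theorems.vpWordQp_proof (prover) · by planner
sources: ValiantSkyumBerkowitzRackoff1983, BenOrCleve1992, BurgisserClausenShokrollahi1997, Literature.Computability.AlgebraicComplexity.isQPBounded_determinantalComplexity_of_isVPFamily_holds
[support] VP ⊆ VQF in word form (hypothesis of the assembly): every VP family has affine elementary
words of quasi-polynomial length — compose the VSBR stage recursion (in-tree GateQuotients /
VPDeterminantalQPProofs template, HasInvRepr ↦ words) with the word algebra: concatenation for sums,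
the commutator [E_12(f),E_23(g)] = E_13(fg) with signed-permutation and diagonal conjugations for
products, ≤ #vars+1 letters for an affine form. [difficulty: M] -/
@[route_item "route-ValiantsHypothesis-ElementaryWordLength", crux]
def VpWordQp : Prop :=
  ∀ {σ : ℕ → Type} [∀ n, Fintype (σ n)] (f : ∀ n, MvPolynomial (σ n) ℂ), Literature.Computability.AlgebraicComplexity.IsVPFamily f → ∃ c : ℕ, ∀ n : ℕ, (∃ w : List (Fin 3 × Fin 3 × ℂ × Option (σ n)), w.length ≤ 2 ^ ((Nat.log 2 n + c) ^ c) ∧ (∀ l ∈ w, l.1 ≠ l.2.1) ∧ (w.map (fun l => Matrix.transvection l.1 l.2.1 (MvPolynomial.C l.2.2.1 * l.2.2.2.elim 1 MvPolynomial.X))).prod = Matrix.transvection (0 : Fin 3) 2 (f n))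

/-- item stmt-ValiantsHypothesis-6629 · support · rank 9 · closed · proved by Summit.ValiantsHypothesis.ValiantsHypothesis.Theorems.ElementaryWordLengthBocSimulation.bocSimulation_proof (prover) · by planner
sources: BenOrCleve1992, BurgisserClausenShokrollahi1997
[support] Ben-Or–Cleve Thm 1 on the tree's circuits: a fan-in-≤2 circuit (weighted sums, products)
of depth d computing f yields an affine elementary word of length ≤ 4^d for E_13(f) (sum:
concatenate; product: four conjugated copies; scalars by diagonal conjugation; leaves one letter).
[difficulty: provable-now] -/
@[route_item "route-ValiantsHypothesis-ElementaryWordLength", crux]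
def BocSimulation : Prop :=
  ∀ {σ : Type} (P : Literature.Computability.AlgebraicComplexity.ArithCircuit ℂ σ) (f : MvPolynomial σ ℂ), P.IsFanInTwo → P.Computes f → (∃ w : List (Fin 3 × Fin 3 × ℂ × Option (σ)), w.length ≤ 4 ^ P.depth ∧ (∀ l ∈ w, l.1 ≠ l.2.1) ∧ (w.map (fun l => Matrix.transvection l.1 l.2.1 (MvPolynomial.C l.2.2.1 * l.2.2.2.elim 1 MvPolynomial.X))).prod = Matrix.transvection (0 : Fin 3) 2 (f))

/-- item stmt-ValiantsHypothesis-6630 · support · rank 9 · closed · proved by Summit.ValiantsHypothesis.ValiantsHypothesis.Theorems.ElementaryWordLength.wordToFormula_proof @ 2b58f62a17b8 (prover) · by planner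
sources: BenOrCleve1992, BringmannIkenmeyerZuiddam2018, BurgisserClausenShokrollahi1997
[support] the converse dictionary row: a word of length L for E_13(f) gives a fan-in-2 formula of
size ≤ 20(L+1)³ for f (divide and conquer on the matrix product: F(L) ≤ 6F(L/2)+5, exponent log₂6 <
2.59). [difficulty: provable-now] -/
@[route_item "route-ValiantsHypothesis-ElementaryWordLength", crux]
def WordToFormula : Prop :=
  ∀ {σ : Type} (f : MvPolynomial σ ℂ) (L : ℕ), (∃ w : List (Fin 3 × Fin 3 × ℂ × Option (σ)), w.length ≤ L ∧ (∀ l ∈ w, l.1 ≠ l.2.1) ∧ (w.map (fun l => Matrix.transvection l.1 l.2.1 (MvPolynomial.C l.2.2.1 * l.2.2.2.elim 1 MvPolynomial.X))).prod = Matrix.transvection (0 : Fin 3) 2 (f)) → Literature.Computability.AlgebraicComplexity.formulaComplexity f ≤ 20 * (L + 1) ^ 3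

/-- item stmt-ValiantsHypothesis-6631 · assembly · rank 1 · closed · proved by Summit.ValiantsHypothesis.Theorems.elementaryWordLength_assembly_proof @ 18f42850584c (prover) · by planner
sources: Valiant1979, Burgisser2000, BenOrCleve1992, ValiantSkyumBerkowitzRackoff1983
[assembly] VpWordQp → WordLengthQP → (perFamily ℂ ∈ VP ℂ ↔ IsVPFamily per) → per ∈ VNP →
ValiantsHypothesis. -/
@[route_item "route-ValiantsHypothesis-ElementaryWordLength", crux]
def Assembly : Prop :=
  VpWordQp → WordLengthQP → (Literature.Computability.AlgebraicComplexity.perFamily ℂ ∈ Literature.Computability.AlgebraicComplexity.VP ℂ ↔ Literature.Computability.AlgebraicComplexity.IsVPFamily (fun n => Literature.Computability.AlgebraicComplexity.perPoly (Fin n) ℂ)) → Literature.Computability.AlgebraicComplexity.perFamily_mem_VNP ℂ → ValiantsHypothesis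

/-! D-0027 §2.1 — DECIDING THEOREM (planner-authored via `route open/edit --closes-file`; by planner-rbadge-ValiantsHypothesis-ElementaryWo-c873cac7-g2-0 2026-08-15T16:13:36Z):
its hypotheses are this route's items and its conclusion the sub-problem Statement (glue_lint), and it elaborates with this file. -/

@[closes "route-ValiantsHypothesis-ElementaryWordLength"] theorem closes : WordLengthQP → WordPerSuperQuartic → WordPerCubic → WordPerSuperPoly → UnboundedReads → VpWordQp → BocSimulation → WordToFormula → Assembly → _root_.ValiantsHypothesis := by
  intro h_WordLengthQP _ _ _ _ h_VpWordQp _ _ _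
  -- `ValiantsHypothesis` is `VP ℂ ≠ VNP ℂ`; contraposition through the permanent family.
  show Literature.Computability.AlgebraicComplexity.VP ℂ ≠ Literature.Computability.AlgebraicComplexity.VNP ℂ
  intro hEq
  -- Valiant 1979 / Bürgisser 2000 Thm 2.10, PROVED in the tree: `perFamily ℂ ∈ VNP ℂ`.
  have hVNP := Literature.Computability.AlgebraicComplexity.perFamily_mem_VNP_holds ℂ
  have hVP : Literature.Computability.AlgebraicComplexity.perFamily ℂ ∈
      Literature.Computability.AlgebraicComplexity.VP ℂ := by
    unfold Literature.Computability.AlgebraicComplexity.perFamily_mem_VNP at hVNP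
    rw [hEq]; exact hVNP
  -- renaming bridge `ofFintype per ∈ VP ↔ IsVPFamily per` (Bürgisser 2000 Rem 2.2, PROVED in the tree).
  have hfam : Literature.Computability.AlgebraicComplexity.IsVPFamily
      (fun n => Literature.Computability.AlgebraicComplexity.perPoly (Fin n) ℂ) :=
    (Literature.Computability.AlgebraicComplexity.mem_VP_ofFintype_iff_holds _).1 hVP
  -- VP ⊆ VQF in word form gives quasi-polynomial words for E_13(per_n), contradicting X.
  exact h_WordLengthQP (h_VpWordQp _ hfam)

end Summit.ValiantsHypothesis.ValiantsHypothesis.Theses.ElementaryWordLength
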